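import Summits.CriticalPhenomena.SAWScalingLimit.Theses.SAWRestrictionRigidity
import Summits.CriticalPhenomena.SAWScalingLimit.Theorems.SAWRestrictionRigidityRigidityNoLinearSymmetry
import Summits.CriticalPhenomena.SAWScalingLimit.Theorems.SAWRestrictionRigidityRigidityQuarterTurnDescent
import Summits.CriticalPhenomena.SAWScalingLimit.Theorems.SAWRestrictionRigidityRigidityCovarianceTransport
import Summits.CriticalPhenomena.SAWScalingLimit.Theorems.SAWRestrictionRigidityRigidityTransportAxioms

/-!
# Skeleton (line `registered` = birth, reshaped by the lead 2026-08-17) for crux `Rigidity` (stmt-CriticalPhenomena-1368), route SAWRestrictionRigidity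

Line `birth`: the Beffara dichotomy written as three lemmas.

* `stub_linearModulusCore` (hardest, the conjectural core "at most the linear modulus", minimal
  form; reshaped 2026-08-17 from the birth stub `stub_linearModulus`): a chordal family with
  two-sided restriction, the restriction-coupled domain Markov property, reversibility, covariance
  under DILATIONS AND TRANSLATIONS `z ↦ r z + w` (`r > 0`) and under complex conjugation, carried by
  simple boundary-avoiding curves, is the real-linear image of a conformally covariant family: there
  is `L : ℂ ≃L[ℝ] ℂ` such that `S D = (L⁻¹)_* P (L D)` is conformally covariant. (v4: the crux
  hypotheses are kept verbatim, rotations included, so the stub is implied by the crux; a proof may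
  ignore the rotations — the expected answer for the SAW limit of a sheared lattice `L ℤ²` is exactly
  `L_* SLE_{8/3}`, Beffara 2008 Prop. 4.)
* `stub_transportAxioms` (bookkeeping): such a transport `S` is again chordal, restriction, simple.
* `stub_noLinearSymmetry` (known technology, real work): a chordal, conformally covariant,
  restriction family on simple boundary-avoiding curves (= chordal SLE_{8/3} in every domain, by the
  tree theorem behind `LSWRestrictionFact83`) has no hidden linear symmetry: if it is covariant
  under a real-linear automorphism `M` of `ℂ`, then `M` is complex-linear or complex-antilinear.
* `stub_quarterTurnDescent` + `stub_covarianceTransport` (lead's reshape of the birth stub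
  `stub_modulusPinned`, "the quarter-turn spends the modulus"): if `S = (L⁻¹)_* P (L ·)` has no
  non-(anti)conformal linear symmetry and `P` is covariant under the lattice similarity group
  `z ↦ r iᵏ z + w`, then `M = L⁻¹ ∘ (i ·) ∘ L` is a linear symmetry of `S` with `M² = -1`, hence `L`
  is complex-(anti)linear (3a); and conformal covariance of `S` transports through such an `L` back
  to `P` (3b).

`Rigidity_of : Rigidity` assembles them into the crux BY NAME (stubs used by name; no other input).

Status (lead, 2026-08-17): `stub_noLinearSymmetry`, `stub_quarterTurnDescent`, `stub_covarianceTransport` are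
LANDED (Theorems/SAWRestrictionRigidityRigidity{NoLinearSymmetry,QuarterTurnDescent,CovarianceTransport}.lean,
p143784 / p143740 / p143758) and `stub_transportAxioms` (Theorems/SAWRestrictionRigidityRigidityTransportAxioms.lean, p144751) are LANDED and imported here by name; the only remaining `sorry` is the conjectural core `stub_linearModulusCore` (R* minus the quarter-turn, modulo a linear modulus — open in print). The kernel-checked reduction `rigidity_of_linearModulusCore : core → Rigidity` is Theorems/SAWRestrictionRigidityRigidityOfLinearModulusCore.lean.
-/

namespace Summit.CriticalPhenomena.SAWScalingLimit.Cruxes.Rigidity.Birth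

open MeasureTheory

/-- stub 1 (hardest; the conjectural core "the crux modulo a linear modulus", reshaped by the lead,
v4): under the crux hypotheses VERBATIM (chordal, two-sided restriction, restriction-coupled Markov,
reversibility, covariance under the lattice similarity group `z ↦ r·iᵏ·z + w` and under conjugation,
simple boundary-avoiding curves), for some real-linear automorphism `L` of the plane the transported
family `S D = (L⁻¹)_* (P (L D))` is conformally covariant. This is IMPLIED by the crux (`L = id`,
`S = P`), hence cannot be falser than it; the point of the cut is that a proof may work
GL₂(ℝ)-equivariantly and produce ANY modulus `L` — the quarter-turn is spent afterwards by landed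
algebra (`stub_quarterTurnDescent`, `stub_covarianceTransport`), and the other axioms of `S` are formal
(`stub_transportAxioms`). A prover is free to ignore the rotations (`k` odd) in the hypothesis: the
rotation-free form (v3) is the natural GL₂-invariant classification "dilation + translation +
conjugation covariant restriction–Markov families are linear images of SLE(8/3)" (Beffara 2008
Prop. 4 / §2.2; LSW04 "we do not know how to prove … conformally covariant"). Open in print. -/
theorem stub_linearModulusCore : ∀ P : Literature.Probability.RandomPlanarGeometry.ChordalFamily, P.IsChordal → P.IsRestriction → (∃ Q : Literature.Probability.RandomPlanarGeometry.DobrushinDomain → Literature.Probability.RandomPlanarGeometry.CurveClass ℂ → MeasureTheory.Measure (Literature.Probability.RandomPlanarGeometry.CurveClass ℂ), P.IsMarkovExtension Q ∧ ∀ (D : Literature.Probability.RandomPlanarGeometry.DobrushinDomain) (p : Literature.Probability.RandomPlanarGeometry.CurveClass ℂ) (D' : Literature.Probability.RandomPlanarGeometry.DobrushinDomain), D'.carrier ⊆ Literature.Probability.RandomPlanarGeometry.remainingDomain D p → D'.pt 0 = p.target → D'.pt 1 = D.pt 1 → ∀ T : Set (Literature.Probability.RandomPlanarGeometry.CurveClass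 ℂ), MeasurableSet T → P D' T * Q D p (Literature.Probability.RandomPlanarGeometry.CurveClass.rangeSubset (closure D'.carrier)) = Q D p (T ∩ Literature.Probability.RandomPlanarGeometry.CurveClass.rangeSubset (closure D'.carrier))) → (∀ D D' : Literature.Probability.RandomPlanarGeometry.DobrushinDomain, D'.carrier = D.carrier → D'.pt 0 = D.pt 1 → D'.pt 1 = D.pt 0 → P D' = (P D).map Literature.Probability.RandomPlanarGeometry.CurveClass.reverse) → (∀ (D : Literature.Probability.RandomPlanarGeometry.DobrushinDomain) (c : ℂ) (hc : c ≠ 0) (w : ℂ), (∃ (r : ℝ) (k : ℕ), 0 < r ∧ c = (r : ℂ) * Complex.I ^ k) → P (D.map (Literature.Probability.RandomPlanarGeometry.similarity c hc w)) = (P D).map (Literature.Probability.RandomPlanarGeometry.CurveClass.map (Literature.Probability.RandomPlanarGeometry.similarity c hc w : C(ℂ, ℂ)))) → (∀ D : Literature.Probability.RandomPlanarGeometry.DobrushinDomain, P (D.map Complex.conjLIE.toHomeomorph) = (P D).map (Literature.Probability.RandomPlanarGeometry.CurveClass.map (Complex.conjLIE.toHomeomorph : C(ℂ, ℂ)))) →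 (∀ D : Literature.Probability.RandomPlanarGeometry.DobrushinDomain, ∀ᵐ γ ∂(P D), γ ∈ Literature.Probability.RandomPlanarGeometry.CurveClass.simple ∧ γ.range ∩ frontier D.carrier ⊆ {D.pt 0, D.pt 1}) → ∃ (L : ℂ ≃L[ℝ] ℂ) (S : Literature.Probability.RandomPlanarGeometry.ChordalFamily), (∀ D : Literature.Probability.RandomPlanarGeometry.DobrushinDomain, S D = (P (D.map L.toHomeomorph)).map (Literature.Probability.RandomPlanarGeometry.CurveClass.map (L.symm.toHomeomorph : C(ℂ, ℂ)))) ∧ S.IsConformallyCovariant := by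
  sorry

/-- Assembly (real proof, no `sorry` of its own): the composition
`stub_linearModulusCore → stub_transportAxioms → stub_noLinearSymmetry → stub_quarterTurnDescent →
stub_covarianceTransport → Rigidity`, with the stubs supplied BY NAME. From the crux hypotheses,
`stub_linearModulusCore` (fed the `k = 0` sub-case of the lattice-similarity covariance) produces the
modulus `L` and the conformally covariant transport `S`; `stub_transportAxioms` gives `S` the remaining
axioms (chordal, restriction, simple); `stub_noLinearSymmetry` applied to `S` says `S` has no
non-(anti)conformal linear symmetry; `stub_quarterTurnDescent` spends the quarter-turn of `P` to make
`L` complex-(anti)linear; `stub_covarianceTransport` carries conformal covariance from `S` back to `P`. -/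
theorem Rigidity_of : Summit.CriticalPhenomena.SAWScalingLimit.Theses.SAWRestrictionRigidity.Rigidity := by
  intro P hch hres hmk hrev hsim hconj hsimple
  -- stub 1: the linear modulus `L` and the conformally covariant transport `S`
  obtain ⟨L, S, hS, h0cc⟩ :=
    stub_linearModulusCore P hch hres hmk hrev hsim hconj hsimple
  -- stub 1': the transported family keeps the other axioms
  obtain ⟨h0ch, h0res, h0simple⟩ := stub_transportAxioms P S L hS hch hres hsimple
  -- stub 3a pins the modulus, fed stub 2 (no hidden linear symmetry of `S`) and the quarter-turn of `P`
  have hL : (∃ c : ℂ, ∀ z : ℂ, L z = c * z) ∨ (∃ c : ℂ, ∀ z : ℂ, L z = c * (starRingEnd ℂ) z) :=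
    stub_quarterTurnDescent P S L hS hsim
      (fun M hM => stub_noLinearSymmetry S M h0ch h0cc h0res h0simple hM)
  -- stub 3b transports conformal covariance from `S` back to `P`
  exact stub_covarianceTransport P S L hS h0cc hL

end Summit.CriticalPhenomena.SAWScalingLimit.Cruxes.Rigidity.Birth
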